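import Mathlib
import Summits.Ventures.PercRepro2.SepSplitPendant
import Summits.Ventures.PercRepro2.TypedPendantRoot
import Summits.Ventures.PercRepro2.TypedPendantRootA2
import Summits.Ventures.PercRepro2.TypedPendantA3

/-!
# Gluing at a general separator, XIX: the pendant ROOT — the single-edge-bundle chain orbit sums
with a far root are twice the typed counts of the pendant-root kernels on the root side (blind
cell PercRepro2, mine-2 g50, 2026-08-29; `conjectures/MINE-2.md` M2-106; g49's successor item (ii))

`SepSplitPendant` reads the `S₃`-orbit sum of the glued root counts of a one-edge far side as
`2 · N(G)` (`orbitRootS_pendant_two / _one`); when that far edge `f = {a₁, u}` carries the root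
`a₁` as a leaf (the separator vertex `u` its only neighbour), `TypedPendantRoot` reads `N(G)` as
the typed count on the root side `G − a₁` of the pendant-root kernels.  Together
(**`orbitRootS_pendant_root_two / _one`**): the chain-single orbit sum of the far triple
`(q₀, q₁, q₁)` (resp. `(q₁, q₀, q₀)`) is `2 · typedCount (F ∖ {f}) (z[f := 0]) τ (KA1two ∘ S)`
(resp. `KA1one`), `S` the states with `f` open (`a₁ := u`) — so the SIGN of these live orbits
(the open question of M2-103 add. 1 for single-edge bundles with a far root) IS the typed
pendant-root class of row 2′TRI, the typed form of p4's `T2 ≥ 0` / `T1 ≥ 0`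
(`typedCount_KA1two_nonneg_iff_orbitRootS`, `typedCount_KA1one_nonneg_iff_orbitRootS`); the
mirror at the far root `a₂` (`orbitRootS_pendant_root_two' / _one'`, `TypedPendantRootA2`).  With
the far mark `a₃` a leaf, night-3's quadratic identity (`typedCount_pendant_a3_quadratic`) reads
the orbit as `2 · (N_{τ[f:=1]} + N_{τ[f:=3]} − N_{τ[f:=0]})` (`orbitRootS_pendant_two_of_leaf_a3`).
Together with g49's `orbitRootS_pendant_two_of_leaf_o / _b` every single-edge-bundle chain orbit
with ONE far mark is, in the kernel, a typed count of a smaller or a reduced instance: row 2′TRI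
on `G − {mark}` with the mark moved onto the separator vertex (`o, b`), the typed root-leaf
coefficients (`a₁, a₂`), or the `a₃` quadratic identity.  Own work; standard axioms.
-/

namespace Summit.Ventures.PercRepro2

open UnionCluster

namespace CovForm

namespace RootBridge

open OneTyped TypedA3 Untouched TypedFactor Separated TypedRed

section PendantRoot

open Classical

variable {V : Type*} {E : Type*} {ι : Type*} [Fintype E] [DecidableEq E] [Fintype ι]
  [DecidableEq ι] {R : Type*} [Field R]
variable (ends : E → Sym2 V) (mk : Fin 5 → V) (σ : ι → V)

/-- **The pendant-root orbit, type `2`**: with the far side the single edge `f = {a₁, u}` carrying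
the root `a₁` as a leaf, the orbit sum of `(q₀, q₁, q₁)` is twice the typed count of `KA1two` on
the root side (types in `{1, 2}` on `F`). -/
theorem orbitRootS_pendant_root_two {side : Fin 5 → Bool} {VL VH : Set V} {F : Finset E} {f : E}
    {u : V} (hf : ends f = s(mk 1, u)) (hleaf : ∀ e, mk 1 ∈ ends e → e = f) (h1u : mk 1 ≠ u)
    (h1o : mk 1 ≠ mk 0) (h12 : mk 1 ≠ mk 2) (h13 : mk 1 ≠ mk 3) (h1b : mk 1 ≠ mk 4)
    (hA : sideF ends VL F = {f}) (hfF : f ∈ F) (z : Config E) (τ : E → ℕ)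
    (hτF : ∀ e ∈ F, τ e = 1 ∨ τ e = 2) (hτ : τ f = 2) (h : SepSplit ends mk σ side VL VH F z) :
    orbitRootS ends mk σ side VH (sideF ends VH F) z τ
        (pendData ends mk σ VL f z false, pendData ends mk σ VL f z true,
          pendData ends mk σ VL f z true) =
      2 * typedCount (F.erase f) (Function.update z f false) τ
        (fun x y w => ((KA1two (st ends (mk 0) (mk 1) (mk 2) (mk 3) (mk 4) (Function.update x f true))
          (st ends (mk 0) (mk 1) (mk 2) (mk 3) (mk 4) (Function.update y f true))
          (st ends (mk 0) (mk 1) (mk 2) (mk 3) (mk 4) (Function.update w f true)) : ℤ) : R)) := by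
  rw [orbitRootS_pendant_two ends mk σ hA z τ hτ h,
    typedCount_pendant_a1_eq_KA1two ends (mk 0) (mk 1) (mk 2) (mk 3) (mk 4) hf hleaf h1u h1o h12
      h13 h1b F hfF z τ hτF hτ]

/-- **The pendant-root orbit, type `1`**: the orbit sum of `(q₁, q₀, q₀)` is twice the typed count
of `KA1one` on the root side. -/
theorem orbitRootS_pendant_root_one {side : Fin 5 → Bool} {VL VH : Set V} {F : Finset E} {f : E}
    {u : V} (hf : ends f = s(mk 1, u)) (hleaf : ∀ e, mk 1 ∈ ends e → e = f) (h1u : mk 1 ≠ u)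
    (h1o : mk 1 ≠ mk 0) (h12 : mk 1 ≠ mk 2) (h13 : mk 1 ≠ mk 3) (h1b : mk 1 ≠ mk 4)
    (hA : sideF ends VL F = {f}) (hfF : f ∈ F) (z : Config E) (τ : E → ℕ)
    (hτF : ∀ e ∈ F, τ e = 1 ∨ τ e = 2) (hτ : τ f = 1) (h : SepSplit ends mk σ side VL VH F z) :
    orbitRootS ends mk σ side VH (sideF ends VH F) z τ
        (pendData ends mk σ VL f z true, pendData ends mk σ VL f z false,
          pendData ends mk σ VL f z false) =
      2 * typedCount (F.erase f) (Function.update z f false) τ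
        (fun x y w => ((KA1one (st ends (mk 0) (mk 1) (mk 2) (mk 3) (mk 4) (Function.update x f true))
          (st ends (mk 0) (mk 1) (mk 2) (mk 3) (mk 4) (Function.update y f true))
          (st ends (mk 0) (mk 1) (mk 2) (mk 3) (mk 4) (Function.update w f true)) : ℤ) : R)) := by
  rw [orbitRootS_pendant_one ends mk σ hA z τ hτ h,
    typedCount_pendant_a1_eq_KA1one ends (mk 0) (mk 1) (mk 2) (mk 3) (mk 4) hf hleaf h1u h1o h12
      h13 h1b F hfF z τ hτF hτ]

/-- **The pendant-root orbit at `a₂`, type `2`**: with the far side the single edge `f = {a₂, u}`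
carrying the root `a₂` as a leaf, the orbit sum of `(q₀, q₁, q₁)` is twice the typed count of
`KA2two` on the root side. -/
theorem orbitRootS_pendant_root_two' {side : Fin 5 → Bool} {VL VH : Set V} {F : Finset E} {f : E}
    {u : V} (hf : ends f = s(mk 2, u)) (hleaf : ∀ e, mk 2 ∈ ends e → e = f) (h2u : mk 2 ≠ u)
    (h2o : mk 2 ≠ mk 0) (h21 : mk 2 ≠ mk 1) (h23 : mk 2 ≠ mk 3) (h2b : mk 2 ≠ mk 4)
    (hA : sideF ends VL F = {f}) (hfF : f ∈ F) (z : Config E) (τ : E → ℕ)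
    (hτF : ∀ e ∈ F, τ e = 1 ∨ τ e = 2) (hτ : τ f = 2) (h : SepSplit ends mk σ side VL VH F z) :
    orbitRootS ends mk σ side VH (sideF ends VH F) z τ
        (pendData ends mk σ VL f z false, pendData ends mk σ VL f z true,
          pendData ends mk σ VL f z true) =
      2 * typedCount (F.erase f) (Function.update z f false) τ
        (fun x y w => ((KA2two (st ends (mk 0) (mk 1) (mk 2) (mk 3) (mk 4) (Function.update x f true))
          (st ends (mk 0) (mk 1) (mk 2) (mk 3) (mk 4) (Function.update y f true))
          (st ends (mk 0) (mk 1) (mk 2) (mk 3) (mk 4) (Function.update w f true)) : ℤ) : R)) := by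
  rw [orbitRootS_pendant_two ends mk σ hA z τ hτ h,
    typedCount_pendant_a2_eq_KA2two ends (mk 0) (mk 1) (mk 2) (mk 3) (mk 4) hf hleaf h2u h2o h21
      h23 h2b F hfF z τ hτF hτ]

/-- **The pendant-root orbit at `a₂`, type `1`.** -/
theorem orbitRootS_pendant_root_one' {side : Fin 5 → Bool} {VL VH : Set V} {F : Finset E} {f : E}
    {u : V} (hf : ends f = s(mk 2, u)) (hleaf : ∀ e, mk 2 ∈ ends e → e = f) (h2u : mk 2 ≠ u)
    (h2o : mk 2 ≠ mk 0) (h21 : mk 2 ≠ mk 1) (h23 : mk 2 ≠ mk 3) (h2b : mk 2 ≠ mk 4)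
    (hA : sideF ends VL F = {f}) (hfF : f ∈ F) (z : Config E) (τ : E → ℕ)
    (hτF : ∀ e ∈ F, τ e = 1 ∨ τ e = 2) (hτ : τ f = 1) (h : SepSplit ends mk σ side VL VH F z) :
    orbitRootS ends mk σ side VH (sideF ends VH F) z τ
        (pendData ends mk σ VL f z true, pendData ends mk σ VL f z false,
          pendData ends mk σ VL f z false) =
      2 * typedCount (F.erase f) (Function.update z f false) τ
        (fun x y w => ((KA2one (st ends (mk 0) (mk 1) (mk 2) (mk 3) (mk 4) (Function.update x f true))
          (st ends (mk 0) (mk 1) (mk 2) (mk 3) (mk 4) (Function.update y f true))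
          (st ends (mk 0) (mk 1) (mk 2) (mk 3) (mk 4) (Function.update w f true)) : ℤ) : R)) := by
  rw [orbitRootS_pendant_one ends mk σ hA z τ hτ h,
    typedCount_pendant_a2_eq_KA2one ends (mk 0) (mk 1) (mk 2) (mk 3) (mk 4) hf hleaf h2u h2o h21
      h23 h2b F hfF z τ hτF hτ]

/-- **The far mark `a₃` a leaf at the pendant edge** (type `2`): by the quadratic identity the
orbit sum is `2 · (N_{τ[f:=1]} + N_{τ[f:=3]} − N_{τ[f:=0]})`. -/
theorem orbitRootS_pendant_two_of_leaf_a3 {side : Fin 5 → Bool} {VL VH : Set V} {F : Finset E}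
    {f : E} {u : V} (hf : ends f = s(mk 3, u)) (hleaf : ∀ e, mk 3 ∈ ends e → e = f)
    (h3u : mk 3 ≠ u) (h3o : mk 3 ≠ mk 0) (h31 : mk 3 ≠ mk 1) (h32 : mk 3 ≠ mk 2)
    (h3b : mk 3 ≠ mk 4) (hA : sideF ends VL F = {f}) (hfF : f ∈ F) (z : Config E) (τ : E → ℕ)
    (hτ : τ f = 2) (h : SepSplit ends mk σ side VL VH F z) :
    orbitRootS ends mk σ side VH (sideF ends VH F) z τ
        (pendData ends mk σ VL f z false, pendData ends mk σ VL f z true,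
          pendData ends mk σ VL f z true) =
      2 * (typedCount F z (Function.update τ f 1)
          (K3 ends (mk 0) (mk 1) (mk 2) (mk 3) (mk 4) : Config E → Config E → Config E → R) +
        typedCount F z (Function.update τ f 3) (K3 ends (mk 0) (mk 1) (mk 2) (mk 3) (mk 4)) -
        typedCount F z (Function.update τ f 0) (K3 ends (mk 0) (mk 1) (mk 2) (mk 3) (mk 4))) := by
  rw [orbitRootS_pendant_two ends mk σ hA z τ hτ h]
  have hq := typedCount_pendant_a3_quadratic ends (mk 0) (mk 1) (mk 2) (mk 3) (mk 4) hf hleaf h3u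
    h3o h31 h32 h3b F hfF z τ (R := R)
  have hτ2 : Function.update τ f 2 = τ := by
    rw [← hτ]
    exact Function.update_eq_self f τ
  rw [hτ2] at hq
  linear_combination 2 * hq

/-- **The far mark `a₃` a leaf at the pendant edge** (type `1`): the orbit sum is
`2 · (N_{τ[f:=0]} + N_{τ[f:=2]} − N_{τ[f:=3]})`. -/
theorem orbitRootS_pendant_one_of_leaf_a3 {side : Fin 5 → Bool} {VL VH : Set V} {F : Finset E}
    {f : E} {u : V} (hf : ends f = s(mk 3, u)) (hleaf : ∀ e, mk 3 ∈ ends e → e = f)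
    (h3u : mk 3 ≠ u) (h3o : mk 3 ≠ mk 0) (h31 : mk 3 ≠ mk 1) (h32 : mk 3 ≠ mk 2)
    (h3b : mk 3 ≠ mk 4) (hA : sideF ends VL F = {f}) (hfF : f ∈ F) (z : Config E) (τ : E → ℕ)
    (hτ : τ f = 1) (h : SepSplit ends mk σ side VL VH F z) :
    orbitRootS ends mk σ side VH (sideF ends VH F) z τ
        (pendData ends mk σ VL f z true, pendData ends mk σ VL f z false,
          pendData ends mk σ VL f z false) =
      2 * (typedCount F z (Function.update τ f 0)
          (K3 ends (mk 0) (mk 1) (mk 2) (mk 3) (mk 4) : Config E → Config E → Config E → R) +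
        typedCount F z (Function.update τ f 2) (K3 ends (mk 0) (mk 1) (mk 2) (mk 3) (mk 4)) -
        typedCount F z (Function.update τ f 3) (K3 ends (mk 0) (mk 1) (mk 2) (mk 3) (mk 4))) := by
  rw [orbitRootS_pendant_one ends mk σ hA z τ hτ h]
  have hq := typedCount_pendant_a3_quadratic ends (mk 0) (mk 1) (mk 2) (mk 3) (mk 4) hf hleaf h3u
    h3o h31 h32 h3b F hfF z τ (R := R)
  have hτ1 : Function.update τ f 1 = τ := by
    rw [← hτ]
    exact Function.update_eq_self f τ
  rw [hτ1] at hq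
  linear_combination (-2) * hq

end PendantRoot

/-! ## The sign -/

section Sign

open Classical

variable {V : Type*} {E : Type*} {ι : Type*} [Fintype E] [DecidableEq E] [Fintype ι]
  [DecidableEq ι] {R : Type*} [Field R] [LinearOrder R] [IsStrictOrderedRing R]
variable (ends : E → Sym2 V) (mk : Fin 5 → V) (σ : ι → V)

/-- **The sign of the type-`2` pendant-root orbit IS the typed pendant-root class**: the orbit sum
is nonnegative iff the typed count of `KA1two` on the root side is. -/
theorem typedCount_KA1two_nonneg_iff_orbitRootS {side : Fin 5 → Bool} {VL VH : Set V}
    {F : Finset E} {f : E} {u : V} (hf : ends f = s(mk 1, u)) (hleaf : ∀ e, mk 1 ∈ ends e → e = f)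
    (h1u : mk 1 ≠ u) (h1o : mk 1 ≠ mk 0) (h12 : mk 1 ≠ mk 2) (h13 : mk 1 ≠ mk 3)
    (h1b : mk 1 ≠ mk 4) (hA : sideF ends VL F = {f}) (hfF : f ∈ F) (z : Config E) (τ : E → ℕ)
    (hτF : ∀ e ∈ F, τ e = 1 ∨ τ e = 2) (hτ : τ f = 2) (h : SepSplit ends mk σ side VL VH F z) :
    (0 ≤ typedCount (F.erase f) (Function.update z f false) τ
        (fun x y w => ((KA1two (st ends (mk 0) (mk 1) (mk 2) (mk 3) (mk 4) (Function.update x f true))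
          (st ends (mk 0) (mk 1) (mk 2) (mk 3) (mk 4) (Function.update y f true))
          (st ends (mk 0) (mk 1) (mk 2) (mk 3) (mk 4) (Function.update w f true)) : ℤ) : R))) ↔
      (0 : R) ≤ orbitRootS ends mk σ side VH (sideF ends VH F) z τ
        (pendData ends mk σ VL f z false, pendData ends mk σ VL f z true,
          pendData ends mk σ VL f z true) := by
  rw [orbitRootS_pendant_root_two ends mk σ hf hleaf h1u h1o h12 h13 h1b hA hfF z τ hτF hτ h]
  constructor
  · intro hN
    exact mul_nonneg (by norm_num : (0 : R) ≤ 2) hN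
  · intro hO
    exact (mul_nonneg_iff_of_pos_left (by norm_num : (0 : R) < 2)).mp hO

/-- **The sign of the type-`1` pendant-root orbit IS the typed pendant-root class.** -/
theorem typedCount_KA1one_nonneg_iff_orbitRootS {side : Fin 5 → Bool} {VL VH : Set V}
    {F : Finset E} {f : E} {u : V} (hf : ends f = s(mk 1, u)) (hleaf : ∀ e, mk 1 ∈ ends e → e = f)
    (h1u : mk 1 ≠ u) (h1o : mk 1 ≠ mk 0) (h12 : mk 1 ≠ mk 2) (h13 : mk 1 ≠ mk 3)
    (h1b : mk 1 ≠ mk 4) (hA : sideF ends VL F = {f}) (hfF : f ∈ F) (z : Config E) (τ : E → ℕ)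
    (hτF : ∀ e ∈ F, τ e = 1 ∨ τ e = 2) (hτ : τ f = 1) (h : SepSplit ends mk σ side VL VH F z) :
    (0 ≤ typedCount (F.erase f) (Function.update z f false) τ
        (fun x y w => ((KA1one (st ends (mk 0) (mk 1) (mk 2) (mk 3) (mk 4) (Function.update x f true))
          (st ends (mk 0) (mk 1) (mk 2) (mk 3) (mk 4) (Function.update y f true))
          (st ends (mk 0) (mk 1) (mk 2) (mk 3) (mk 4) (Function.update w f true)) : ℤ) : R))) ↔
      (0 : R) ≤ orbitRootS ends mk σ side VH (sideF ends VH F) z τ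
        (pendData ends mk σ VL f z true, pendData ends mk σ VL f z false,
          pendData ends mk σ VL f z false) := by
  rw [orbitRootS_pendant_root_one ends mk σ hf hleaf h1u h1o h12 h13 h1b hA hfF z τ hτF hτ h]
  constructor
  · intro hN
    exact mul_nonneg (by norm_num : (0 : R) ≤ 2) hN
  · intro hO
    exact (mul_nonneg_iff_of_pos_left (by norm_num : (0 : R) < 2)).mp hO

end Sign

end RootBridge

end CovForm

end Summit.Ventures.PercRepro2
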